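import Literature.AlgebraicGeometry.Morphisms.ContainmentRepOfPushforward
import Literature.AlgebraicGeometry.Modules.PullbackTensorOfLocallyFree
import Literature.AlgebraicGeometry.Modules.InvertibleModule
import Literature.AlgebraicGeometry.Modules.DetClassOfIso
import HarnessLib

/-!
# Containment read on the push-forward, after an invertible twist: `pr^* φ = 0 ⟺ b^*(p_*(φ ⊗ 𝒪_X(n))) = 0`

[MumfordFogartyKirwan1994] Ch. 6 §3 Prop. 6.16 / [EGAIII2] 7.7: the twist by `𝒪_X(n)`, `n ≫ 0`, is what makes the two sheaf inputs of
★ `ContainmentRepOfPushforward` hold — (hgen) `p^* p_*(F ⊗ L) ↠ F ⊗ L` (relative Serre) and (hbc) «`p_*(G ⊗ L)` commutes with base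
change» — while the vanishing condition upstairs is INSENSITIVE to the twist: for an invertible `L`, `g^*(φ ⊗ 𝟙_L) = 0 ⟺ g^* φ = 0`.

THIS FILE proves that insensitivity (§1, `pullback_map_tensorMap_id_eq_zero_iff`: ★ `PullbackTensorOfLocallyFree.pullbackTensorNatIsoOfRight`
«`g^*(M ⊗ L) ≅ g^*M ⊗ g^*L` naturally in `M`», ★ `InvertibleModule` «`L ⊗ –` is an equivalence for `L` locally free of rank `1`»,
braiding ★ `TensorBraiding.tensorComm`) and assembles (§2) the (h6-d) chain on Mathlib's chosen fibre products:
**`pullback_fst_map_eq_zero_iff_twist`** — for `φ : F ⟶ F'`, `L` finite locally free of rank `1`, (hgen) for `F ⊗ L` and (hbc) for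
`F' ⊗ L` along every base change,
`∀ b : T ⟶ S, (pullback.fst p b)^* φ = 0 ⟺ (Scheme.Modules.pullback b).map ((Scheme.Modules.pushforward p).map (φ ⊗ 𝟙_L)) = 0`.
With `φ := ι : 𝓘_Z ⟶ 𝒪_X` (★ `Modules/IdealSheafOfClosedImmersion.idealSheafOfι`) the right-hand side is ★ `ContainmentLocusClosed`'s
`hrep` right-hand side for `u := p_*(ι ⊗ 𝟙_L) : p_*(𝓘_Z(n)) ⟶ p_*(𝒪_X(n))`, and the left-hand side is `𝓘 ≤ (pullback.fst p b).ker` by the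
ideal-sheaf bridge «`𝓘 ≤ g.ker ⟺ g^*(ι) = 0`» (★ `Morphisms/IdealSheafLeKerPullback`, B-p15 (g11)).

Theorems only; no `sorry`, no instance, no named fact.  Cell hodgecm-mathlib, F-DAG second wave (h6-d) FILE C.  HC_CM is proved only
modulo the printed citations until rung 0 closes; this file discharges none of them.

## References
* [MumfordFogartyKirwan1994] D. Mumford, J. Fogarty, F. Kirwan, *Geometric Invariant Theory*, 3rd ed. (1994), Ch. 6 §3 Prop. 6.16
  (p. 126).
* [StacksProject] The Stacks Project, Tag 01CA (Lemma 17.16.4: `f^*` and `⊗`), Tag 01CS (Definition 17.25.1: invertible modules),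
  Tag 0B8M (Lemma 17.25.4).
* [Hartshorne1977] R. Hartshorne, *Algebraic Geometry* (1977), II Ex. 5.1 (b), III Theorem 12.11.
-/

noncomputable section

-- `TopCat.Presheaf`/`Scheme.Modules` are not reducible (as in Mathlib's `AlgebraicGeometry/Modules/Sheaf.lean`).
set_option backward.isDefEq.respectTransparency false

open CategoryTheory CategoryTheory.Limits AlgebraicGeometry

universe u

namespace Literature.AlgebraicGeometry.Morphisms

open Literature.AlgebraicGeometry.Modules Literature.AlgebraicGeometry.Motives

/-! ### §1 Vanishing after pull-back is insensitive to an invertible twist -/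

section Twist

variable {X T : Scheme.{u}} (g : T ⟶ X) {F F' : X.Modules} (φ : F ⟶ F') {L : X.Modules}

/-- **Tensoring with an invertible module is faithful**: for `L` finite locally free of rank `1` and `ψ : M ⟶ M'`,
`ψ ⊗ 𝟙_L = 0 ⟺ ψ = 0` (`L ⊗ –` is an equivalence, [StacksProject, Tag 01CS / 0B8M]; pass to `– ⊗ L` by the braiding).
[cite: StacksProject, Tag 01CS (Modules, Definition 17.25.1)] [cite: StacksProject, Tag 0B8M (Modules, Lemma 17.25.4)] -/
theorem tensorMap_id_eq_zero_iff {M M' : X.Modules} (ψ : M ⟶ M') (hL : IsFiniteLocallyFree L) (h₁ : HasRank L 1) :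
    tensorMap ψ (𝟙 L) = 0 ↔ ψ = 0 := by
  constructor
  · intro h
    haveI := (isInvertibleModule_of_hasRank_one hL h₁).faithful
    haveI : ((tensorBifunctor X).obj L).Additive := additive_tensorBifunctor_obj L
    have h' : tensorMap (𝟙 L) ψ = 0 := by
      rw [← cancel_epi (tensorComm M L).hom, ← tensorMap_tensorComm_hom, h, zero_comp, comp_zero]
    apply ((tensorBifunctor X).obj L).map_injective
    rw [tensorBifunctor_obj_map, h', Functor.map_zero]
  · rintro rfl
    exact tensorMap_zero_left _

/-- **`g^*(φ ⊗ 𝟙_L) = 0 ⟺ g^* φ = 0` for `L` finite locally free of rank `1`**: `g^*(M ⊗ L) ≅ g^*M ⊗ g^*L` naturally in `M`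
(★ `pullbackTensorNatIsoOfRight`, [StacksProject, Tag 01CA]) turns `g^*(φ ⊗ 𝟙_L)` into `g^*φ ⊗ 𝟙_{g^*L}`, and `g^*L` is again locally
free of rank `1` (★ `IsFiniteLocallyFree.pullback`, ★ `hasRank_pullback`), hence invertible. [cite: StacksProject, Tag 01CA (Lemma 17.16.4)]
[cite: StacksProject, Tag 0B8M (Modules, Lemma 17.25.4)] -/
theorem pullback_map_tensorMap_id_eq_zero_iff (hL : IsFiniteLocallyFree L) (h₁ : HasRank L 1) :
    (Scheme.Modules.pullback g).map (tensorMap φ (𝟙 L)) = 0 ↔ (Scheme.Modules.pullback g).map φ = 0 := by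
  have key : (Scheme.Modules.pullback g).map (tensorMap φ (𝟙 L)) ≫ (pullbackTensorIsoOfRight g hL F').hom =
      (pullbackTensorIsoOfRight g hL F).hom ≫
        tensorMap ((Scheme.Modules.pullback g).map φ) (𝟙 ((Scheme.Modules.pullback g).obj L)) :=
    (pullbackTensorNatIsoOfRight g hL).hom.naturality φ
  rw [← tensorMap_id_eq_zero_iff ((Scheme.Modules.pullback g).map φ) (hL.pullback g) (hasRank_pullback g h₁)]
  constructor
  · intro h
    rw [h, zero_comp] at key
    rw [← cancel_epi (pullbackTensorIsoOfRight g hL F).hom, ← key, comp_zero]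
  · intro h
    rw [h, comp_zero] at key
    rw [← cancel_mono (pullbackTensorIsoOfRight g hL F').hom, key, zero_comp]

end Twist

/-! ### §2 The (h6-d) chain on the chosen fibre products -/

section Assembly

variable {X S : Scheme.{u}} (p : X ⟶ S) {F F' : X.Modules} (φ : F ⟶ F') {L : X.Modules}

/-- **`(pullback.fst p b)^* φ = 0 ⟺ b^*(p_*(φ ⊗ 𝟙_L)) = 0` for every `b : T ⟶ S`** — the containment condition read on the base
through the TWISTED push-forwards ([MumfordFogartyKirwan1994] Prop. 6.16 pattern): (hgen) `p^*p_*(F ⊗ L) ↠ F ⊗ L`, (hbc) the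
base-change morphism of `F' ⊗ L` is a monomorphism along every base change (★ `PushforwardBaseChangeHom`), and `L` is locally
free of rank `1` (§1).  = ★ `ContainmentRepOfPushforward.pullback_fst_map_eq_zero_iff` at `φ ⊗ 𝟙_L` + §1.
[cite: MumfordFogartyKirwan1994, Ch. 6 §3 Prop. 6.16 (p. 126)] [cite: Hartshorne1977, III Theorem 12.11] -/
theorem pullback_fst_map_eq_zero_iff_twist (hL : IsFiniteLocallyFree L) (h₁ : HasRank L 1)
    [Epi ((Scheme.Modules.pullbackPushforwardAdjunction p).counit.app (tensorObj F L))]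
    (hbc : ∀ ⦃T : Scheme.{u}⦄ (b : T ⟶ S),
      Mono (pushforwardBaseChangeHom (pullback.condition (f := p) (g := b)) (tensorObj F' L)))
    ⦃T : Scheme.{u}⦄ (b : T ⟶ S) :
    (Scheme.Modules.pullback (pullback.fst p b)).map φ = 0 ↔
      (Scheme.Modules.pullback b).map ((Scheme.Modules.pushforward p).map (tensorMap φ (𝟙 L))) = 0 := by
  rw [← pullback_map_tensorMap_id_eq_zero_iff (pullback.fst p b) φ hL h₁]
  exact pullback_fst_map_eq_zero_iff p (tensorMap φ (𝟙 L)) hbc b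

/-- The same over an arbitrary commutative square `pr ≫ p = pT ≫ b` presenting the base change.
[cite: MumfordFogartyKirwan1994, Ch. 6 §3 Prop. 6.16 (p. 126)] -/
theorem pullback_map_eq_zero_iff_twist_of_sq (hL : IsFiniteLocallyFree L) (h₁ : HasRank L 1)
    [Epi ((Scheme.Modules.pullbackPushforwardAdjunction p).counit.app (tensorObj F L))]
    {T XT : Scheme.{u}} {pr : XT ⟶ X} {pT : XT ⟶ T} {b : T ⟶ S} (w : pr ≫ p = pT ≫ b)
    (hbc : Mono (pushforwardBaseChangeHom w (tensorObj F' L))) :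
    (Scheme.Modules.pullback pr).map φ = 0 ↔
      (Scheme.Modules.pullback b).map ((Scheme.Modules.pushforward p).map (tensorMap φ (𝟙 L))) = 0 := by
  rw [← pullback_map_tensorMap_id_eq_zero_iff pr φ hL h₁]
  exact pullback_map_eq_zero_iff_of_sq p (tensorMap φ (𝟙 L)) w hbc

end Assembly

end Literature.AlgebraicGeometry.Morphisms

end
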